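import Mathlib
import Literature.MathematicalPhysics.QuantumFieldTheory.Balaban1983to89.TreeLengthCubeSystem
import Literature.MathematicalPhysics.QuantumFieldTheory.Balaban1983to89.B13Ineq232Star
import Literature.MathematicalPhysics.QuantumFieldTheory.Balaban1983to89.B13Sect1Statements

/-!
# `Balaban1983to89.B13Ineq230Printed` — T. Bałaban, *Renormalization group approach to lattice gauge field theories.
II. Cluster expansions*, Commun. Math. Phys. **116** (1988) 1–22 [Balaban1988RG2Cluster]: the display (2.30) p. 18
AS PRINTED as a named `Prop`, its lower half and the first inequality of (1.28) p. 8 REFUTED AS PRINTED on the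
concrete system of localization domains, its upper half and the forms the tree uses instead PROVED there

statement-level skeleton of published theorems with citation tags; proofs where landed; nothing here is a claim about
the Yang–Mills mass gap

PDF held: `paper:balaban1988-cmp116-rg-ii-cluster` (journal page = PDF page + 0); the two displays were re-read this
session from the text layer `p0018.txt` / `p0008.txt` of that key and agree with the verbatim quotations already in
`…Balaban1983to89.TreeLength` (p. 18) and `…Balaban1983to89.B13Sect1Arith` / `…B13Sect1Statements` (p. 8).

CITATION HEADER / WHAT IS REPRODUCED (unit `lit-balaban-r10` gen 4, B13 fold owner; SKELETON rows `B13.Eq2.30` and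
the first-inequality member of `B13.Eq1.28` of `HOME/lit-balaban-r10/ROWS-B13.md`; HOME =
`run/shared/lean/pub/lit-balaban/`).  The paper prints, p. 18 [PDF 18]: *"In connection with this notice the following
useful inequality (3·2³)⁻¹M⁻⁴|Y| ≦ d_k(Y) ≦ M⁻⁴|Y| − 1 (2.30) holding for localization domains Y ∈ 𝐃_k."* and,
p. 8 [PDF 8]: *"Finally, the sum over □₀ can be bounded by M⁻⁴|Y| ≦ 3·2³d_k(Y) ≦ exp(1/16)(κ₁ − 2)d_k(Y). (1.28)"*
(M⁻⁴|Y| = the number of cubes of π_k in Y; d_k = the linear size of [Balaban1987RG1] p. 257).  Before this file no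
declaration stated (2.30) whole: its UPPER half is the theorem `TreeLength.treeLen_le_card_sub_one`, its lower half is
recorded FALSE AS PRINTED for domains of linear size 0 (cell GAPS G-B13-07) with the witness `TreeLength.treeLen_singleton`
and the REPAIRED additive form `TreeLength.card_le_treeLen` (|Y| ≤ 2^d(4d_k(Y) + 1)); (1.28) is typed AS PRINTED as
`B13Sect1Statements.Eq128` (record only) with the conditional `B13Sect1Statements.eq128_of_lower230` proved.
This file adds, and nothing else:
* Part A — `Ineq230Printed` / `Ineq230Lower` / `Ineq230Upper`: (2.30) AS PRINTED over the abstract system of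
  localization domains (`LocDomainSys`, tree length `dj` = d_k) and a cube count `vol` = M⁻⁴|Y| (the frame of
  `B13Sect1Statements.Eq128`); `ineq230Lower_of_eq128`: the first inequality of (1.28) IS the lower half of (2.30).
* Part B — on the CONCRETE window system `TreeLengthCubeSystem.sys B` (domains = the non-empty face-connected
  families X ⊆ B of unit cubes of ℤ^d, d_k := `TreeLength.treeLen`, cube count `count B X` = `X.card`): the one-cube domain
  `single` and the two-cube domain `pair` (two cubes with a common wall) have linear size 0
  (`TreeLength.treeLen_singleton`, `B13Ineq232Star.treeLen_pair_of_adj`).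
* Part C — REFUTATIONS AS PRINTED: `not_ineq230Lower_sys`, `not_ineq230Printed_sys` (every non-empty window) and
  `ineq230Lower_fails_at_pair` (the failure is not confined to one-cube domains: |Y| = 2, d_k(Y) = 0);
  `not_eq128_sys`: `B13Sect1Statements.Eq128` AS PRINTED fails on every non-empty window, for every κ₁.
* Part D — WHAT HOLDS on the concrete system: `ineq230Upper_sys` (the printed upper half, every d),
  `ineq230Lower_repaired_sys` (the additive lower bound), and — in the regime in which p. 8 uses (1.28), *"we sum over
  X with d_j(X) ≠ 0, as it follows from our inductive construction"*, read as d_k(Y) ≥ 1 — the printed SHAPE of the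
  lower half with the constant 5·2^d in place of 3·2³ (`ineq230Lower_of_one_le`; d = 4: 1/80 for the printed 1/24,
  which the tree neither proves nor refutes for d_k ≥ 1), the second inequality of (1.28) (`eq128_second_of_one_le`,
  κ₁ ≥ 2 + 16 log 24) and the CONCLUSION the paper draws from (1.28), the □₀-count bound
  M⁻⁴|Y| ≤ exp((1/16)(κ₁ − 2)d_k(Y)) (`count_le_exp_sys`, κ₁ ≥ 2 + 16 log(8·2^d)), by `B13Sect1Arith.bound_128_repaired`.
Conventions of `treeLen` (sup metric, closed cubes, polygonal graphs) are those of `…Balaban1983to89.TreeLength`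
(cell DIVERGENCE D-pv22.1/2); the refutations use only that a one-point graph inside a cube, or on a common wall,
meets the (closed) cubes containing it — the reading [Balaban1987RG1] p. 257 prints (*"graphs contained in X and
intersecting all the cubes in X"*).  No named fact is introduced (D-0026): three `Prop`s with bodies, two concrete
domains, theorems.
-/

namespace Literature.MathematicalPhysics.QuantumFieldTheory.Balaban1983to89.B13Ineq230Printed

open Literature.MathematicalPhysics.QuantumFieldTheory.Balaban1983to89
open Literature.MathematicalPhysics.QuantumFieldTheory.Balaban1983to89.B13ScaleTransfer
open Literature.MathematicalPhysics.QuantumFieldTheory.Balaban1983to89.TreeLength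
open Literature.MathematicalPhysics.QuantumFieldTheory.Balaban1983to89.TreeLengthCubeSystem

/-! ## Part A. (2.30) AS PRINTED over the abstract system of localization domains -/

/-- **(2.30)** p. 18 [PDF 18], verbatim: *"In connection with this notice the following useful inequality
(3·2³)⁻¹M⁻⁴|Y| ≦ d_k(Y) ≦ M⁻⁴|Y| − 1 (2.30) holding for localization domains Y ∈ 𝐃_k."* — typed AS PRINTED over
the system `D` of localization domains 𝐃_k (tree length `D.dj` = d_k) with the cube count `vol Y` = M⁻⁴|Y|: both
inequalities, for every Y.  RECORD: the first inequality is FALSE AS PRINTED (`not_ineq230Printed_sys` below); the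
second is a theorem (`ineq230Upper_sys`). [cite: Balaban1988RG2Cluster, (2.30) p.18] -/
def Ineq230Printed (D : LocDomainSys) (vol : D.Dom → ℕ) : Prop :=
  ∀ Y : D.Dom, (3 * 2 ^ 3 : ℝ)⁻¹ * (vol Y : ℝ) ≤ D.dj Y ∧ D.dj Y ≤ (vol Y : ℝ) - 1

/-- The LOWER half of (2.30) p. 18 as printed: *"(3·2³)⁻¹M⁻⁴|Y| ≦ d_k(Y)"* for every localization domain Y.
[cite: Balaban1988RG2Cluster, (2.30) p.18] -/
def Ineq230Lower (D : LocDomainSys) (vol : D.Dom → ℕ) : Prop :=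
  ∀ Y : D.Dom, (3 * 2 ^ 3 : ℝ)⁻¹ * (vol Y : ℝ) ≤ D.dj Y

/-- The UPPER half of (2.30) p. 18 as printed: *"d_k(Y) ≦ M⁻⁴|Y| − 1"* for every localization domain Y.
[cite: Balaban1988RG2Cluster, (2.30) p.18] -/
def Ineq230Upper (D : LocDomainSys) (vol : D.Dom → ℕ) : Prop :=
  ∀ Y : D.Dom, D.dj Y ≤ (vol Y : ℝ) - 1

/-- (2.30) as printed is the conjunction of its two halves. [cite: Balaban1988RG2Cluster, (2.30) p.18] -/
theorem ineq230Printed_iff (D : LocDomainSys) (vol : D.Dom → ℕ) :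
    Ineq230Printed D vol ↔ Ineq230Lower D vol ∧ Ineq230Upper D vol :=
  ⟨fun h => ⟨fun Y => (h Y).1, fun Y => (h Y).2⟩, fun h Y => ⟨h.1 Y, h.2 Y⟩⟩

/-- The lower half of (2.30) in the multiplied-out form in which (1.28) p. 8 prints it, *"M⁻⁴|Y| ≦ 3·2³d_k(Y)"*.
[cite: Balaban1988RG2Cluster, (2.30) p.18] -/
theorem ineq230Lower_iff (D : LocDomainSys) (vol : D.Dom → ℕ) :
    Ineq230Lower D vol ↔ ∀ Y : D.Dom, (vol Y : ℝ) ≤ 3 * 2 ^ 3 * D.dj Y := by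
  refine forall_congr' fun Y => ?_
  exact inv_mul_le_iff₀ (by norm_num : (0 : ℝ) < 3 * 2 ^ 3)

/-- The first inequality of (1.28) p. 8 (`B13Sect1Statements.Eq128`, typed AS PRINTED) IS the lower half of (2.30).
[cite: Balaban1988RG2Cluster, (1.28) p.8] -/
theorem ineq230Lower_of_eq128 {D : LocDomainSys} {vol : D.Dom → ℕ} {κ₁ : ℝ}
    (h : B13Sect1Statements.Eq128 D vol κ₁) : Ineq230Lower D vol :=
  (ineq230Lower_iff D vol).2 fun Y => (h Y).1

/-! ## Part B. Two degenerate localization domains of the concrete window system -/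

variable {d : ℕ}

/-- The cube count M⁻⁴|Y| of (2.30) p. 18 / (1.28) p. 8 (*"the number of cubes of π_k in Y"*) on the concrete window
system `TreeLengthCubeSystem.sys B`: the number of (unit, rescaled) cubes of the family, `Y.card`
(= `TreeLengthCubeSystem.cubeSys_vol`). [cite: Balaban1988RG2Cluster, (2.30) p.18] -/
def count (B : Finset (Pt d)) (X : (sys B).Dom) : ℕ := X.1.card

/-- `count` is the cardinality of the family. [cite: Balaban1988RG2Cluster, (2.30) p.18] -/
theorem count_eq (B : Finset (Pt d)) (X : (sys B).Dom) : count B X = X.1.card := rfl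

/-- A one-cube family is face-connected (the chain condition of [Balaban1987RG1] p. 257 is vacuous). [folklore] -/
private theorem faceConnected_singleton (x : Pt d) : FaceConnected ({x} : Finset (Pt d)) := by
  intro a ha b hb
  rw [Finset.mem_singleton] at ha hb
  subst ha; subst hb
  exact Relation.ReflTransGen.refl

/-- Two cubes with a common wall form a face-connected family. [folklore] -/
private theorem faceConnected_pair {a b : Pt d} (h : Adj a b) : FaceConnected ({a, b} : Finset (Pt d)) := by
  have hab : Linked ({a, b} : Finset (Pt d)) a b := linked_of_stepIn ⟨by simp, by simp, h⟩
  intro x hx y hy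
  simp only [Finset.mem_insert, Finset.mem_singleton] at hx hy
  rcases hx with rfl | rfl <;> rcases hy with rfl | rfl
  · exact Relation.ReflTransGen.refl
  · exact hab
  · exact hab.symm
  · exact Relation.ReflTransGen.refl

/-- Two cubes with a common wall are distinct. [folklore] -/
private theorem ne_of_adj {a b : Pt d} (h : Adj a b) : a ≠ b := by
  rintro rfl
  obtain ⟨i, h | h⟩ := h
  · have := congrFun h i
    simp only [Function.update_self] at this
    linarith
  · have := congrFun h i
    simp only [Function.update_self] at this
    linarith

/-- The one-cube localization domain {x} of the window B (x ∈ B): a single cube of π_k is a localization domain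
([Balaban1987RG1] p. 257: a connected finite family of cubes). [cite: Balaban1987RG1, p.257 (localization domains)] -/
def single (B : Finset (Pt d)) (x : Pt d) (hx : x ∈ B) : Dom B :=
  ⟨{x}, Finset.singleton_subset_iff.2 hx, Finset.singleton_nonempty x, faceConnected_singleton x⟩

/-- The cubes of `single B x hx` are {x}. [cite: Balaban1987RG1, p.257 (localization domains)] -/
@[simp] theorem single_val (B : Finset (Pt d)) (x : Pt d) (hx : x ∈ B) : (single B x hx).1 = {x} := rfl

/-- A one-cube domain has M⁻⁴|Y| = 1. [cite: Balaban1987RG1, p.257 (localization domains)] -/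
@[simp] theorem count_single (B : Finset (Pt d)) (x : Pt d) (hx : x ∈ B) : count B (single B x hx) = 1 := by
  rw [count_eq, single_val, Finset.card_singleton]

/-- A one-cube domain has linear size d_k = 0 (`TreeLength.treeLen_singleton`: the one-point graph at a corner).
[cite: Balaban1987RG1, p.257 (linear size d_j)] -/
@[simp] theorem dj_single (B : Finset (Pt d)) (x : Pt d) (hx : x ∈ B) : (sys B).dj (single B x hx) = 0 := by
  rw [sys_dj, single_val, treeLen_singleton]

/-- The two-cube localization domain {a, b} of the window B for two cubes a, b ∈ B with a common wall.
[cite: Balaban1987RG1, p.257 (localization domains)] -/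
def pair (B : Finset (Pt d)) (a b : Pt d) (ha : a ∈ B) (hb : b ∈ B) (h : Adj a b) : Dom B :=
  ⟨{a, b}, Finset.insert_subset_iff.2 ⟨ha, Finset.singleton_subset_iff.2 hb⟩, Finset.insert_nonempty a {b},
    faceConnected_pair h⟩

/-- The cubes of `pair B a b …` are {a, b}. [cite: Balaban1987RG1, p.257 (localization domains)] -/
@[simp] theorem pair_val (B : Finset (Pt d)) (a b : Pt d) (ha : a ∈ B) (hb : b ∈ B) (h : Adj a b) :
    (pair B a b ha hb h).1 = {a, b} := rfl

/-- A two-cube domain (common wall) has M⁻⁴|Y| = 2 cubes. [cite: Balaban1987RG1, p.257 (localization domains)] -/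
@[simp] theorem count_pair (B : Finset (Pt d)) (a b : Pt d) (ha : a ∈ B) (hb : b ∈ B) (h : Adj a b) :
    count B (pair B a b ha hb h) = 2 := by
  rw [count_eq, pair_val, Finset.card_pair (ne_of_adj h)]

/-- A two-cube domain (common wall) has linear size d_k = 0 (`B13Ineq232Star.treeLen_pair_of_adj`: the one-point
graph at a point of the common wall meets both closed cubes). [cite: Balaban1987RG1, p.257 (linear size d_j)] -/
@[simp] theorem dj_pair (B : Finset (Pt d)) (a b : Pt d) (ha : a ∈ B) (hb : b ∈ B) (h : Adj a b) :
    (sys B).dj (pair B a b ha hb h) = 0 := by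
  rw [sys_dj, pair_val, B13Ineq232Star.treeLen_pair_of_adj h]

/-! ## Part C. The lower half of (2.30), and (1.28), REFUTED AS PRINTED on the concrete system -/

/-- **(2.30) lower half, FALSE AS PRINTED** on the concrete system of localization domains of every non-empty window B
(cube count M⁻⁴|Y| = `Y.card`, d_k = `treeLen`): the one-cube domain has (3·2³)⁻¹·1 > 0 = d_k.  (Cell GAPS G-B13-07;
the paper uses the inequality only for domains with d_k ≠ 0, p. 8.) [cite: Balaban1988RG2Cluster, (2.30) p.18] -/
theorem not_ineq230Lower_sys {B : Finset (Pt d)} (hB : B.Nonempty) :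
    ¬ Ineq230Lower (sys B) (count B) := by
  obtain ⟨x, hx⟩ := hB
  intro h
  have h1 := h (single B x hx)
  rw [dj_single, count_single] at h1
  norm_num at h1

/-- **(2.30) FALSE AS PRINTED** (its lower half fails) on the concrete system of every non-empty window.
[cite: Balaban1988RG2Cluster, (2.30) p.18] -/
theorem not_ineq230Printed_sys {B : Finset (Pt d)} (hB : B.Nonempty) :
    ¬ Ineq230Printed (sys B) (count B) := fun h =>
  not_ineq230Lower_sys hB ((ineq230Printed_iff _ _).1 h).1

/-- The failure of the lower half of (2.30) is not confined to one-cube domains: for two cubes with a common wall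
(a genuine union of cubes *"such that two consecutive cubes have a common wall"*, [Balaban1987RG1] p. 257) the printed
left side is (3·2³)⁻¹·2 > 0 = d_k. [cite: Balaban1988RG2Cluster, (2.30) p.18] -/
theorem ineq230Lower_fails_at_pair (B : Finset (Pt d)) (a b : Pt d) (ha : a ∈ B) (hb : b ∈ B) (h : Adj a b) :
    ¬ ((3 * 2 ^ 3 : ℝ)⁻¹ * (count B (pair B a b ha hb h) : ℝ) ≤ (sys B).dj (pair B a b ha hb h)) := by
  rw [dj_pair, count_pair]
  norm_num

/-- **(1.28) FALSE AS PRINTED** (its first inequality = the lower half of (2.30) fails): the record `Prop`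
`B13Sect1Statements.Eq128` does not hold on the concrete system of any non-empty window, for any κ₁; what the paper
USES of (1.28) is `count_le_exp_sys` below (d_k(Y) ≥ 1) and `B13Sect1Statements.eq128_of_lower230`.
[cite: Balaban1988RG2Cluster, (1.28) p.8] -/
theorem not_eq128_sys {B : Finset (Pt d)} (hB : B.Nonempty) (κ₁ : ℝ) :
    ¬ B13Sect1Statements.Eq128 (sys B) (count B) κ₁ := fun h =>
  not_ineq230Lower_sys hB (ineq230Lower_of_eq128 h)

/-! ## Part D. What holds on the concrete system: the upper half, the repaired lower half, the p. 8 regime -/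

/-- **(2.30) upper half PROVED** on the concrete system of every window, every dimension: d_k(Y) ≤ M⁻⁴|Y| − 1
(`TreeLength.treeLen_le_card_sub_one`, the chain of cube corners). [cite: Balaban1988RG2Cluster, (2.30) p.18] -/
theorem ineq230Upper_sys (B : Finset (Pt d)) : Ineq230Upper (sys B) (count B) := fun X => by
  show treeLen X.1 ≤ (X.1.card : ℝ) - 1
  exact treeLen_le_card_sub_one X.2.2.1 X.2.2.2

/-- (2.30) lower half in the REPAIRED additive form the tree proves (cell GAPS G-B13-07), on the concrete system:
M⁻⁴|Y| ≤ 2^d(4d_k(Y) + 1) (`TreeLength.card_le_treeLen`; d = 4: |Y| ≤ 64d_k(Y) + 16).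
[cite: Balaban1988RG2Cluster, (2.30) p.18] -/
theorem ineq230Lower_repaired_sys (B : Finset (Pt d)) (X : (sys B).Dom) :
    (count B X : ℝ) ≤ 2 ^ d * (4 * (sys B).dj X + 1) := by
  show (X.1.card : ℝ) ≤ 2 ^ d * (4 * treeLen X.1 + 1)
  exact card_le_treeLen X.2.2.1 X.2.2.2

/-- (2.30) lower half in the regime in which the paper uses it (p. 8: *"we sum over X with d_j(X) ≠ 0, as it follows
from our inductive construction"*, read as d_k(Y) ≥ 1): the printed SHAPE holds on the concrete system with the
constant 5·2^d in place of the printed 3·2³ — (5·2^d)⁻¹M⁻⁴|Y| ≤ d_k(Y) (d = 4: 1/80; from |Y| ≤ 2^d(4d_k + 1) ≤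
5·2^d·d_k).  The printed constant 1/24 for d_k ≥ 1 is neither proved nor refuted here. [cite: Balaban1988RG2Cluster, (2.30) p.18] -/
theorem ineq230Lower_of_one_le {B : Finset (Pt d)} (X : (sys B).Dom) (h1 : 1 ≤ (sys B).dj X) :
    (5 * 2 ^ d : ℝ)⁻¹ * (count B X : ℝ) ≤ (sys B).dj X := by
  have hc := ineq230Lower_repaired_sys B X
  have h2d : (0 : ℝ) < 2 ^ d := by positivity
  have h5 : (count B X : ℝ) ≤ 5 * 2 ^ d * (sys B).dj X := by
    calc (count B X : ℝ) ≤ 2 ^ d * (4 * (sys B).dj X + 1) := hc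
      _ ≤ 2 ^ d * (5 * (sys B).dj X) := by gcongr; linarith
      _ = 5 * 2 ^ d * (sys B).dj X := by ring
  exact (inv_mul_le_iff₀ (by positivity : (0 : ℝ) < 5 * 2 ^ d)).2 h5

/-- (1.28) second inequality, *"3·2³d_k(Y) ≦ exp(1/16)(κ₁ − 2)d_k(Y)"*, for every localization domain with
d_k(Y) ≥ 1 of any system, once κ₁ ≥ 2 + 16 log 24 (the implicit restriction made explicit by
`B13Sect1Arith.bound_128_printed`). [cite: Balaban1988RG2Cluster, (1.28) p.8] -/
theorem eq128_second_of_one_le (D : LocDomainSys) (Y : D.Dom) {κ₁ : ℝ} (h1 : 1 ≤ D.dj Y)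
    (hκ : 2 + 16 * Real.log 24 ≤ κ₁) :
    3 * 2 ^ 3 * D.dj Y ≤ Real.exp ((1 / 16) * (κ₁ - 2) * D.dj Y) := by
  have h := (B13Sect1Arith.bound_128_printed (N := 24 * D.dj Y) le_rfl h1 hκ).1
  have e : (3 : ℝ) * 2 ^ 3 = 24 := by norm_num
  rw [e]
  exact h

/-- **What p. 8 draws from (1.28)**, PROVED on the concrete system in the regime d_k(Y) ≥ 1: *"the sum over □₀ can be
bounded by"* exp((1/16)(κ₁ − 2)d_k(Y)) — the number M⁻⁴|Y| of cubes □₀ ⊂ Y is at most exp((1/16)(κ₁ − 2)d_k(Y)) once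
κ₁ ≥ 2 + 16 log(8·2^d) (d = 4: κ₁ ≥ 2 + 16 log 128 ≈ 79.6), via the repaired lower half |Y| ≤ 4·2^d(d_k(Y) + 1) and
`B13Sect1Arith.bound_128_repaired` (A = 4·2^d, d₀ = 1). [cite: Balaban1988RG2Cluster, (1.28) p.8] -/
theorem count_le_exp_sys {B : Finset (Pt d)} (X : (sys B).Dom) {κ₁ : ℝ} (h1 : 1 ≤ (sys B).dj X)
    (hκ : 2 + 16 * Real.log (8 * 2 ^ d) ≤ κ₁) :
    (count B X : ℝ) ≤ Real.exp ((1 / 16) * (κ₁ - 2) * (sys B).dj X) := by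
  have hc := ineq230Lower_repaired_sys B X
  have h2d : (1 : ℝ) ≤ 2 ^ d := one_le_pow₀ (by norm_num)
  refine B13Sect1Arith.bound_128_repaired (A := 4 * 2 ^ d) (d₀ := 1) (by positivity) one_pos ?_ ?_ h1 ?_
  · have he : Real.exp 1 ≤ 8 := by
      have := Real.exp_one_lt_d9
      linarith
    calc Real.exp 1 ≤ 8 := he
      _ ≤ 4 * 2 ^ d * (1 + 1) := by nlinarith
  · calc (count B X : ℝ) ≤ 2 ^ d * (4 * (sys B).dj X + 1) := hc
      _ ≤ 4 * 2 ^ d * ((sys B).dj X + 1) := by nlinarith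
  · have e : (4 : ℝ) * 2 ^ d * (1 + 1) = 8 * 2 ^ d := by ring
    rw [e]
    linarith

end Literature.MathematicalPhysics.QuantumFieldTheory.Balaban1983to89.B13Ineq230Printed
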